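import Literature.MathematicalPhysics.QuantumFieldTheory.Dimock2011to13.LocalizedExtraction
import Literature.MathematicalPhysics.QuantumFieldTheory.Dimock2011to13.SteinerLengthSums
import Literature.MathematicalPhysics.QuantumFieldTheory.Balaban1983to89.B16MergeGeometry

/-!
# Dimock, *The renormalization group according to Balaban* II (large fields), §3.13 Lemma 3.15 (`first`), steps
# (E)–(H): the split (city) «local terms Y ⊂ Λ_{k+1} + active boundary terms B^{(E)}(Y), Y # Λ_{k+1} + B̃ terms»,
# the regrouping Z ↦ Z⁺, and the bounds (siouZ), (drum1), (drum2), (G.) — PROVED as finite-sum bookkeeping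

**Citation header (reproduction of PUBLISHED work; template of the Bałaban lattice Yang–Mills cell).**
J. Dimock, *The renormalization group according to Balaban II. Large fields*, J. Math. Phys. **54** (2013) 092301
(= arXiv:1212.5562v2) [Dimock2013BalabanII], §3.13 `\subsection{localization}` TeX L4445–4785 (Lemma 3.15
`\label{first}` L4457–4482, its proof (A)–(H) L4500–4777; the same mechanism is re-used for Lemma 3.16 `second`
L4786 ff. and Lemma 3.17 `third` L5163 ff.: *"The expression `B̃_{k+1,𝚷⁺} terms' will be used repeatedly"* L4489).
TeX line numbers refer to the arXiv source held by the cell on this hub at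
`run/shared/lean/archive/nearmiss/qft-balaban/dimock/src/1212.5562/1212.5562.tex` (7217 lines, sha256[:16]
75c5792fc48eacbc); every quotation below was read there this session.  Dimock's papers are published and refereed and
are the cell's TEMPLATE, not manuscripts under audit; no quantity of the Bałaban series is touched.

**What the paper prints (verbatim; `…` marks an elision).**  (city) L4459–4467: *"δE^+_k(Λ_k, φ⁰_{k+1,𝛀′}, 𝒲_{k,𝛀′})
= Σ_{Y∈𝒟⁰_{k+1}: Y⊂Λ_{k+1}} (δE^+_k)^{loc}(Y, φ⁰_{k+1,𝛀′}, W_k) + Σ_{Y∈𝒟⁰_{k+1}(mod Ω^c_{k+1}), Y#Λ_{k+1}}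
B^{(E)}_{k,𝚷⁺}(Y) + B̃_{k+1,𝚷⁺} terms"*; L4489–4491: *"It refers to functions localized in Λ^c_{k+1} which are bounded by C|Λ^{(k)}_k −
Λ^{(k)}_{k+1}| = C Vol(Λ_k − Λ_{k+1}). Local structure is no longer important for these terms."*  (E) L4652–4663:
*"The function (δE^+_k)^{(iv)}(Z) vanishes unless Z ∩ Λ^c_{k+1} ≠ ∅, Z ∩ Λ_k ≠ ∅ so we can write our expression as
Σ_{Z∈𝒟⁰_{k+1}, Z∩Λ^c_{k+1}≠∅, Z∩Λ_k≠∅} (δE^+_k)^{(iv)}(Z)"* (foreign, L4660).  (G) L4725–4736: *"Terms in (foreign) with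
Z ⊂ Λ^c_{k+1} are the B̃_{k+1,𝚷⁺} terms in (city). These are estimated by 𝒪(1)L³λ_k^{1/4−10ε} Σ_{Z: Z⊂Λ^c_{k+1},
Z∩Λ_k≠∅} e^{−L(κ−κ_0−2)d_{LM}(Z)} ≤ 𝒪(1)L³λ_k^{1/4−10ε} Σ_{□⊂Λ̄_k−Λ_{k+1}} Σ_{Z⊃□} e^{−L(κ−κ_0−2)d_{LM}(Z)} ≤
𝒪(1)L³λ_k^{1/4−10ε}|Λ̄_k − Λ_{k+1}|_{LM}"*.  (H) L4740–4755: *"The remaining terms in (foreign) satisfy Z # Λ_{k+1} and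
yield the active boundary terms … each such Z determines a Z⁺ ∈ 𝒟⁰_{k+1}(mod Ω^c_{k+1}) by taking the union with
all connected components of Ω^c_{k+1} connected to Z, written Z → Z⁺. We define B^{(E)}_{k,𝚷⁺}(Y) =
Σ_{Z#Λ_{k+1}, Z⁺=Y} (δE^+_k)^{(iv)}(Z) Then we have Σ_{Z#Λ_{k+1}} (δE^+_k)^{(iv)}(Z) = Σ_{Y∈𝒟⁰_{k+1}(mod Ω^c_{k+1}),
Y#Λ_{k+1}} B^{(E)}_{k,𝚷⁺}(Y)"*; (siouZ) L4756–4762: *"d_{LM}(Z) ≥ d_{LM}(Z⁺, mod Ω^c_{k+1}) Indeed let τ be a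
minimal tree joining the cubes in Z … Then τ is also a tree joining the cubes in Z⁺ ∩ Ω_{k+1} since Z⁺ ∩ Ω_{k+1} =
Z ∩ Ω_{k+1} ⊂ Z"*; (drum1) L4762–4769: *"|B^{(E)}_{k,𝚷⁺}(Y)| ≤ 𝒪(1)L³λ_k^{1/4−10ε}
e^{−(L(κ−κ_0−2)−κ_0)d_{LM}(Y, mod Ω^c_{k+1})} Σ_{Z⊂Y, Z#Λ_{k+1}} e^{−κ_0 d_{LM}(Z)}"*; (drum2) L4770–4777: *"But the sum
is bounded by 𝒪(1)|Y ∩ Λ_{k+1}|_{LM} ≤ |Y ∩ Ω_{k+1}|_{LM} ≤ 𝒪(1)(d_{LM}(Y ∩ Ω_{k+1}) + 1) = 𝒪(1)(d_{LM}(Y, mod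
Ω^c_{k+1}) + 1) ≤ 𝒪(1)e^{d_{LM}(Y, mod Ω^c_{k+1})} The coefficient of d_{LM}(Y ∩ Ω_{k+1}) is then L(κ−κ_0−2)−κ_0−1"*.

**What is reproduced here (kernel-checked, zero `sorry`).**  The finite-sum skeleton of (E)–(H), for an arbitrary
finite family `P` of NON-EMPTY polymers `Z : Finset C` (cubes of an arbitrary type `C`; print: the `Z ∈ 𝒟⁰_{k+1}`
with `Z ∩ Λ_k ≠ ∅` of (foreign)) and any polymer function `f` (print: `(δE^+_k)^{(iv)}`, or the analogous functions
of Lemmas `second`, `third`):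
* §1 **`sum_eq_inside_add_outside_add_crosses`**: `Σ_{Z∈P} f Z = Σ_{Z⊆Λ} f Z + Σ_{Z ∩ Λ = ∅} f Z + Σ_{Z#Λ} f Z` — the
  trichotomy behind (city) (`X # Λ` is the sibling `LocalizedExtraction.Crosses`, L1756–1761);
* §2 **`bterm P f Λ cpl Y := Σ_{Z∈P, Z#Λ, cpl Z = Y} f Z`** (= `B^{(E)}(Y)` for an abstract completion map `cpl = (Z ↦
  Z⁺)`), **`sum_crosses_eq_sum_bterm`** (the regrouping of (H)), **`city`** (the three-term split as printed);
* §3 **`dl_cpl_inter_le`** (= (siouZ): `d(Z⁺ ∩ Ω) ≤ d(Z)` from `Z⁺ ∩ Ω = Z ∩ Ω ⊆ Z` for ANY length `dl` monotone on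
  non-empty subsets; `d_{LM}(Y, mod Ω^c) = d_{LM}(Y ∩ Ω)` as (drum2) prints), **`abs_bterm_le`** (= (drum1): `|B(Y)| ≤
  c·e^{−a·d(Y∩Ω)}·Σ_{Z⊆Y, Z#Λ} e^{−κ_0 d(Z)}` if `|f Z| ≤ c·e^{−(a+κ_0)d(Z)}`);
* §4 **`sum_le_sum_cubes`** (the union bound `Σ_{Z} ≤ Σ_□ Σ_{Z∋□}`), **`sum_crosses_subset_le`** (= (drum2)'s first
  step: `Σ_{Z⊆Y, Z#Λ} g Z ≤ K·|Y ∩ Λ|` given the one-cube bound `Σ_{Z∋□} g Z ≤ K`), **`abs_bterm_le_exp`** (the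
  assembled `|B(Y)| ≤ c·K·c₁·e^{−(a−1)d(Y∩Ω)}` given `|X| ≤ c₁(d(X) + 1)` — *"The coefficient … is then
  L(κ−κ_0−2)−κ_0−1"*: total rate minus `κ_0` minus `1`);
* §5 **`abs_sum_disjoint_le`** (= (G): `|Σ_{Z⊆Λ^c} f Z| ≤ c·K′·|S − Λ|` for polymers inside an ambient `S = Λ̄_k` —
  *"bounded by C|Λ_k − Λ_{k+1}|"*, the `B̃` shape);
* §6 ON THE CELL'S CUBE CARRIER `Pt d = Fin d → ℤ` with the Steiner length `ℓ̃` (`Balaban1983to89.TreeLength.steinerLen`):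
  **`abs_bterm_le_exp_steiner`** and **`abs_sum_disjoint_le_steiner`** with every side condition DISCHARGED —
  monotonicity by `B16MergeGeometry.steinerLen_mono`, `|X| ≤ 2^{d+2}(ℓ̃(X) + 1)` by `TreeLength.card_le_steinerLen`
  (App. E Lemma E.1 (3)), the one-cube bound by `SteinerLengthSums.kumquat_steiner` (App. E Lemma E.2 (2)) under its
  threshold `3^d e^{−κ_0/(2+2^{d+2})} ≤ 1/8`; constants explicit: `|B(Y)| ≤ c · 2e^{κ_0(2^d−1)/(2+2^{d+2})} · 2^{d+2} ·
  e^{−(a−1)ℓ̃(Y ∩ Ω)}`.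
* §7 a non-vacuity `example`.

**Readings (declared).**  (i) Polymers are non-empty finite sets of cubes; connectivity is not used in (E)–(H) except
through the length `d`, so it is dropped (the print also drops it in (F): *"we drop connectedness conditions"* L4700).  (ii)
`Z ⊂ Λ^c_{k+1}` is `Disjoint Z Λ`; `d_{LM}(Y, mod Ω^c_{k+1})` is `d(Y ∩ Ω_{k+1})` (the print's own equation in (drum2),
L4773–4774).  (iii) `Z⁺` is an abstract map with the two printed properties `Z ⊆ Z⁺`, `Z⁺ ∩ Ω_{k+1} = Z ∩ Ω_{k+1}`
(L4744–4749, L4760–4761) as hypotheses `hcpl`; `Λ_{k+1} ⊆ Ω_{k+1}` (§3.5) as `hΛΩ`.  (iv) The analytic input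
(snuffit) `|(δE^+_k)^{(iv)}(Z)| ≤ 𝒪(1)L³λ_k^{1/4−10ε}e^{−L(κ−κ_0−2)d_{LM}(Z)}` is the hypothesis `hf` with `c =
𝒪(1)L³λ_k^{1/4−10ε}`, `a + κ_0 = L(κ−κ_0−2)`; §6 uses the Steiner length `ℓ̃ ≤ d_{LM}`-type tree length of the cell
(rows «D1 (ninety)», «D1 §4.6» of TEMPLATE.md) in place of `d_{LM}`.

**What is NOT claimed.**  Steps (A)–(D), (F) of the proof (analyticity, the Cauchy bounds, the two decoupling
expansions, the random-walk expansion with `LM` cubes, (snuffit) itself); the definition of `Z⁺` by connected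
components of `Ω^c_{k+1}` and `𝒟⁰_{k+1}(mod Ω^c_{k+1})`; Lemmas `second`, `third` beyond the shared skeleton; anything
of B1–B16 (TEMPLATE.md §4.2 row «D2 §3.13» B-side loci B14 §2–§3, B16 §1 (1.98)–(1.104) untouched).  NOT summit
progress; NOT a statement about any Bałaban paper; NOT continuum; NOT Clay.  NEW leaf; imports the three Literature
modules named (for `Crosses`, `kumquat_steiner` + `card_le_steinerLen`, `steinerLen_mono`); no Summits import;
sub-namespace `…Dimock2011to13.ActiveBoundaryTerms`; modifies nothing.  Unit `b2b-balaban-template` gen 35 (journal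
CLAIM D2-CITY-SPLIT); cell records TEMPLATE.md §4.2 row «D2 §3.13», GAPS C-tmpl35-11.
-/

noncomputable section

open Finset Real

namespace Literature.MathematicalPhysics.QuantumFieldTheory.Dimock2011to13.ActiveBoundaryTerms

open LocalizedExtraction (Crosses)

variable {C : Type*} [DecidableEq C]

/-! ## §1 The trichotomy «Z ⊂ Λ_{k+1} ∕ Z ⊂ Λ^c_{k+1} ∕ Z # Λ_{k+1}» -/

section Split

variable {M : Type*} [AddCommMonoid M]

/-- **The trichotomy behind (city)**: a finite sum over NON-EMPTY polymers splits into the polymers inside `Λ`, the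
polymers outside `Λ` and the polymers crossing `Λ` (`Z # Λ ⟺ Z ∩ Λ ≠ ∅ and Z ∩ Λ^c ≠ ∅`). [cite: Dimock2013BalabanII, §3.13 Lemma 3.15 proof (C), (G), (H) (arXiv:1212.5562v2 TeX L4593, L4725–4727, L4740–4741)] -/
theorem sum_eq_inside_add_outside_add_crosses (P : Finset (Finset C)) (f : Finset C → M) (Λ : Finset C)
    (hP : ∀ Z ∈ P, Z.Nonempty) :
    ∑ Z ∈ P, f Z = ∑ Z ∈ P.filter (· ⊆ Λ), f Z + ∑ Z ∈ P.filter (fun Z => Disjoint Z Λ), f Z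
      + ∑ Z ∈ P.filter (Crosses · Λ), f Z := by
  rw [← Finset.sum_filter_add_sum_filter_not P (· ⊆ Λ), add_assoc]
  congr 1
  rw [← Finset.sum_filter_add_sum_filter_not (P.filter fun Z => ¬ Z ⊆ Λ) (fun Z => Disjoint Z Λ),
    Finset.filter_filter, Finset.filter_filter]
  congr 1
  · refine Finset.sum_congr (Finset.filter_congr fun Z hZ => ⟨fun h => h.2, fun h => ⟨fun hsub => ?_, h⟩⟩)
      fun _ _ => rfl
    obtain ⟨b, hb⟩ := hP Z hZ
    exact Finset.disjoint_left.1 h hb (hsub hb)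
  · refine Finset.sum_congr (Finset.filter_congr fun Z _ => ?_) fun _ _ => rfl
    simp only [Crosses, ← Finset.not_disjoint_iff_nonempty_inter]
    tauto

end Split

/-! ## §2 The active boundary terms `B^{(E)}(Y) = Σ_{Z # Λ_{k+1}, Z⁺ = Y}` and the split (city) -/

section Regroup

variable {M : Type*} [AddCommMonoid M]

/-- **`B^{(E)}_{k,𝚷⁺}(Y) = Σ_{Z # Λ_{k+1}, Z⁺ = Y} (δE^+_k)^{(iv)}(Z)`** for an abstract completion map `cpl = (Z ↦ Z⁺)`.
[cite: Dimock2013BalabanII, §3.13 Lemma 3.15 proof (H) (arXiv:1212.5562v2 TeX L4744–4749)] -/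
def bterm (P : Finset (Finset C)) (f : Finset C → M) (Λ : Finset C) (cpl : Finset C → Finset C) (Y : Finset C) : M :=
  ∑ Z ∈ (P.filter (Crosses · Λ)).filter (fun Z => cpl Z = Y), f Z

/-- **The regrouping of (H)**: *"Then we have Σ_{Z#Λ_{k+1}} (δE^+_k)^{(iv)}(Z) = Σ_{Y∈𝒟⁰_{k+1}(mod Ω^c_{k+1}), Y#Λ_{k+1}}
B^{(E)}_{k,𝚷⁺}(Y)"* — here summed over the image of `Z ↦ Z⁺` (fibres outside the image are empty).
[cite: Dimock2013BalabanII, §3.13 Lemma 3.15 proof (H) (arXiv:1212.5562v2 TeX L4750–4755)] -/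
theorem sum_crosses_eq_sum_bterm (P : Finset (Finset C)) (f : Finset C → M) (Λ : Finset C)
    (cpl : Finset C → Finset C) :
    ∑ Z ∈ P.filter (Crosses · Λ), f Z = ∑ Y ∈ (P.filter (Crosses · Λ)).image cpl, bterm P f Λ cpl Y := by
  unfold bterm
  exact (Finset.sum_fiberwise_of_maps_to (fun Z hZ => Finset.mem_image_of_mem cpl hZ) f).symm

/-- **(city)** — the shape `δE^+_k(Λ_k) = Σ_{Y⊂Λ_{k+1}} (δE^+_k)^{loc}(Y) + Σ_{Y#Λ_{k+1}} B^{(E)}_{k,𝚷⁺}(Y) + B̃_{k+1,𝚷⁺} terms`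
(field arguments suppressed) as the three-term split of a finite sum over non-empty polymers: inside `Λ`, the active
boundary terms regrouped by `Z ↦ Z⁺`, and the terms outside `Λ` (the `B̃` terms). [cite: Dimock2013BalabanII, §3.13 Lemma 3.15 eq. (city) (arXiv:1212.5562v2 TeX L4457–4467, L4725–4755)] -/
theorem city (P : Finset (Finset C)) (f : Finset C → M) (Λ : Finset C) (cpl : Finset C → Finset C)
    (hP : ∀ Z ∈ P, Z.Nonempty) :
    ∑ Z ∈ P, f Z = ∑ Z ∈ P.filter (· ⊆ Λ), f Z
      + ∑ Y ∈ (P.filter (Crosses · Λ)).image cpl, bterm P f Λ cpl Y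
      + ∑ Z ∈ P.filter (fun Z => Disjoint Z Λ), f Z := by
  rw [sum_eq_inside_add_outside_add_crosses P f Λ hP, sum_crosses_eq_sum_bterm P f Λ cpl]
  abel

end Regroup

/-! ## §3 (siouZ) and (drum1) for an abstract length `dl`, monotone on non-empty subsets -/

section Bounds

variable {P : Finset (Finset C)} {Λ Ω : Finset C} {cpl : Finset C → Finset C} (dl : Finset C → ℝ)

/-- **(siouZ)**: *"d_{LM}(Z) ≥ d_{LM}(Z⁺, mod Ω^c_{k+1}) Indeed … τ is also a tree joining the cubes in Z⁺ ∩ Ω_{k+1}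
since Z⁺ ∩ Ω_{k+1} = Z ∩ Ω_{k+1} ⊂ Z"* — for any length monotone on non-empty subsets, with `d(Y, mod Ω^c) = d(Y ∩ Ω)`
and `Z ∩ Ω ⊇ Z ∩ Λ ≠ ∅`. [cite: Dimock2013BalabanII, §3.13 Lemma 3.15 proof (H) eq. (siouZ) (arXiv:1212.5562v2 TeX L4756–4762)] -/
theorem dl_cpl_inter_le (hmono : ∀ A B : Finset C, A.Nonempty → A ⊆ B → dl A ≤ dl B) (hΛΩ : Λ ⊆ Ω)
    {Z : Finset C} (hZ : Crosses Z Λ) (hcplZ : cpl Z ∩ Ω = Z ∩ Ω) : dl (cpl Z ∩ Ω) ≤ dl Z := by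
  rw [hcplZ]
  refine hmono _ _ ?_ Finset.inter_subset_left
  obtain ⟨b, hb⟩ := hZ.1
  rw [Finset.mem_inter] at hb
  exact ⟨b, Finset.mem_inter.2 ⟨hb.1, hΛΩ hb.2⟩⟩

/-- **(drum1)**: *"|B^{(E)}_{k,𝚷⁺}(Y)| ≤ 𝒪(1)L³λ_k^{1/4−10ε} e^{−(L(κ−κ_0−2)−κ_0)d_{LM}(Y, mod Ω^c_{k+1})} Σ_{Z⊂Y,
Z#Λ_{k+1}} e^{−κ_0 d_{LM}(Z)}"* — with `|f Z| ≤ c·e^{−(a+κ_0)d(Z)}` (= (snuffit), `a + κ_0 = L(κ−κ_0−2)`), `a ≥ 0`,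
`Z ⊆ Z⁺`, `Z⁺ ∩ Ω = Z ∩ Ω`: `|B(Y)| ≤ c·e^{−a·d(Y∩Ω)}·Σ_{Z∈P, Z#Λ, Z⊆Y} e^{−κ_0 d(Z)}`. [cite: Dimock2013BalabanII, §3.13 Lemma 3.15 proof (H) eq. (drum1) (arXiv:1212.5562v2 TeX L4762–4769)] -/
theorem abs_bterm_le {f : Finset C → ℝ} {c a κ : ℝ} (hc : 0 ≤ c) (ha : 0 ≤ a)
    (hf : ∀ Z ∈ P, |f Z| ≤ c * exp (-((a + κ) * dl Z)))
    (hmono : ∀ A B : Finset C, A.Nonempty → A ⊆ B → dl A ≤ dl B) (hΛΩ : Λ ⊆ Ω)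
    (hcpl : ∀ Z ∈ P, Crosses Z Λ → Z ⊆ cpl Z ∧ cpl Z ∩ Ω = Z ∩ Ω) (Y : Finset C) :
    |bterm P f Λ cpl Y| ≤ c * exp (-(a * dl (Y ∩ Ω)))
        * ∑ Z ∈ (P.filter (Crosses · Λ)).filter (· ⊆ Y), exp (-(κ * dl Z)) := by
  unfold bterm
  set F := (P.filter (Crosses · Λ)).filter (fun Z => cpl Z = Y) with hF
  calc |∑ Z ∈ F, f Z| ≤ ∑ Z ∈ F, |f Z| := Finset.abs_sum_le_sum_abs _ _
    _ ≤ ∑ Z ∈ F, c * exp (-(a * dl (Y ∩ Ω))) * exp (-(κ * dl Z)) := by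
        refine Finset.sum_le_sum fun Z hZ => ?_
        simp only [hF, Finset.mem_filter] at hZ
        obtain ⟨⟨hZP, hZc⟩, hZY⟩ := hZ
        refine (hf Z hZP).trans ?_
        have h1 : dl (Y ∩ Ω) ≤ dl Z := by
          rw [← hZY]; exact dl_cpl_inter_le dl hmono hΛΩ hZc (hcpl Z hZP hZc).2
        rw [mul_assoc, ← Real.exp_add]
        refine mul_le_mul_of_nonneg_left (Real.exp_le_exp.2 ?_) hc
        have h2 := mul_le_mul_of_nonneg_left h1 ha
        linarith
    _ = c * exp (-(a * dl (Y ∩ Ω))) * ∑ Z ∈ F, exp (-(κ * dl Z)) := by rw [Finset.mul_sum]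
    _ ≤ c * exp (-(a * dl (Y ∩ Ω))) * ∑ Z ∈ (P.filter (Crosses · Λ)).filter (· ⊆ Y), exp (-(κ * dl Z)) := by
        refine mul_le_mul_of_nonneg_left ?_ (by positivity)
        refine Finset.sum_le_sum_of_subset_of_nonneg (fun Z hZ => ?_) fun _ _ _ => (Real.exp_pos _).le
        simp only [hF, Finset.mem_filter] at hZ ⊢
        exact ⟨hZ.1, hZ.2 ▸ (hcpl Z hZ.1.1 hZ.1.2).1⟩

/-! ## §4 The union bound and (drum2) -/

/-- A finite sum over a `biUnion` is at most the sum of the sums, for non-negative summands. [folklore] -/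
private theorem sum_biUnion_le_sum_sum {ι α : Type*} [DecidableEq α] (s : Finset ι) (t : ι → Finset α)
    (g : α → ℝ) (hg : ∀ x, 0 ≤ g x) : ∑ x ∈ s.biUnion t, g x ≤ ∑ i ∈ s, ∑ x ∈ t i, g x := by
  classical
  induction s using Finset.induction_on with
  | empty => simp
  | insert i s hi ih =>
    rw [Finset.biUnion_insert, Finset.sum_insert hi]
    have h := Finset.sum_union_inter (s₁ := t i) (s₂ := s.biUnion t) (f := g)
    have h0 : 0 ≤ ∑ x ∈ t i ∩ s.biUnion t, g x := Finset.sum_nonneg fun x _ => hg x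
    linarith

/-- **The union bound** *"Σ_{Z…} ≤ Σ_{□⊂…} Σ_{Z⊃□}"*: if every polymer of a subfamily `S′ ⊆ P` contains a cube of `T`,
a non-negative sum over `S′` is at most `Σ_{□∈T} Σ_{Z∈P, Z∋□}`. [cite: Dimock2013BalabanII, §3.13 Lemma 3.15 proof (G), (H) (arXiv:1212.5562v2 TeX L4728–4735, L4770–4772)] -/
theorem sum_le_sum_cubes {S' : Finset (Finset C)} (hS' : S' ⊆ P) {T : Finset C}
    (hT : ∀ Z ∈ S', ∃ b ∈ T, b ∈ Z) {g : Finset C → ℝ} (hg : ∀ Z, 0 ≤ g Z) :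
    ∑ Z ∈ S', g Z ≤ ∑ b ∈ T, ∑ Z ∈ P.filter (fun Z => b ∈ Z), g Z := by
  calc ∑ Z ∈ S', g Z ≤ ∑ Z ∈ T.biUnion (fun b => P.filter (fun Z => b ∈ Z)), g Z := by
        refine Finset.sum_le_sum_of_subset_of_nonneg (fun Z hZ => ?_) fun _ _ _ => hg _
        obtain ⟨b, hbT, hbZ⟩ := hT Z hZ
        exact Finset.mem_biUnion.2 ⟨b, hbT, Finset.mem_filter.2 ⟨hS' hZ, hbZ⟩⟩
    _ ≤ ∑ b ∈ T, ∑ Z ∈ P.filter (fun Z => b ∈ Z), g Z := sum_biUnion_le_sum_sum _ _ _ hg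

/-- **(drum2), first step**: *"But the sum is bounded by 𝒪(1)|Y ∩ Λ_{k+1}|_{LM}"* — given the one-cube bound
`Σ_{Z∈P, Z∋□} g Z ≤ K` (App. E Lemma E.2 (2)) for the cubes of `Y ∩ Λ`: `Σ_{Z∈P, Z#Λ, Z⊆Y} g Z ≤ K·|Y ∩ Λ|`.
[cite: Dimock2013BalabanII, §3.13 Lemma 3.15 proof (H) eq. (drum2) (arXiv:1212.5562v2 TeX L4770–4772)] -/
theorem sum_crosses_subset_le {g : Finset C → ℝ} (hg : ∀ Z, 0 ≤ g Z) {K : ℝ} {Y : Finset C}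
    (hK : ∀ b ∈ Y ∩ Λ, ∑ Z ∈ P.filter (fun Z => b ∈ Z), g Z ≤ K) :
    ∑ Z ∈ (P.filter (Crosses · Λ)).filter (· ⊆ Y), g Z ≤ K * ((Y ∩ Λ).card : ℝ) := by
  calc ∑ Z ∈ (P.filter (Crosses · Λ)).filter (· ⊆ Y), g Z
      ≤ ∑ b ∈ Y ∩ Λ, ∑ Z ∈ P.filter (fun Z => b ∈ Z), g Z := by
        refine sum_le_sum_cubes (fun Z hZ => (Finset.mem_filter.1 (Finset.mem_filter.1 hZ).1).1)
          (fun Z hZ => ?_) hg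
        simp only [Finset.mem_filter] at hZ
        obtain ⟨⟨_, ⟨b, hb⟩, _⟩, hZY⟩ := hZ
        rw [Finset.mem_inter] at hb
        exact ⟨b, Finset.mem_inter.2 ⟨hZY hb.1, hb.2⟩, hb.1⟩
    _ ≤ ∑ b ∈ Y ∩ Λ, K := Finset.sum_le_sum hK
    _ = K * ((Y ∩ Λ).card : ℝ) := by rw [Finset.sum_const, nsmul_eq_mul, mul_comm]

/-- **(drum1) + (drum2) assembled**: *"… ≤ |Y ∩ Ω_{k+1}|_{LM} ≤ 𝒪(1)(d_{LM}(Y ∩ Ω_{k+1}) + 1) … ≤ 𝒪(1)e^{d_{LM}(Y, mod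
Ω^c_{k+1})} The coefficient of d_{LM}(Y ∩ Ω_{k+1}) is then L(κ−κ_0−2)−κ_0−1"* — with the one-cube bound `K`, the
linear volume bound `|X| ≤ c₁(d(X) + 1)` and `d ≥ 0`: `|B(Y)| ≤ c·K·c₁·e^{−(a−1)·d(Y∩Ω)}`. [cite: Dimock2013BalabanII, §3.13 Lemma 3.15 proof (H) eqs. (drum1)–(drum2) (arXiv:1212.5562v2 TeX L4762–4777)] -/
theorem abs_bterm_le_exp {f : Finset C → ℝ} {c a κ K c₁ : ℝ} (hc : 0 ≤ c) (ha : 0 ≤ a)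
    (hf : ∀ Z ∈ P, |f Z| ≤ c * exp (-((a + κ) * dl Z)))
    (hmono : ∀ A B : Finset C, A.Nonempty → A ⊆ B → dl A ≤ dl B) (hdl : ∀ X, 0 ≤ dl X) (hΛΩ : Λ ⊆ Ω)
    (hcpl : ∀ Z ∈ P, Crosses Z Λ → Z ⊆ cpl Z ∧ cpl Z ∩ Ω = Z ∩ Ω)
    (hK : ∀ b ∈ Λ, ∑ Z ∈ P.filter (fun Z => b ∈ Z), exp (-(κ * dl Z)) ≤ K) (hK0 : 0 ≤ K)
    (hcard : ∀ X : Finset C, X.Nonempty → (X.card : ℝ) ≤ c₁ * (dl X + 1)) (hc₁ : 0 ≤ c₁) (Y : Finset C) :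
    |bterm P f Λ cpl Y| ≤ c * K * c₁ * exp (-((a - 1) * dl (Y ∩ Ω))) := by
  have hsum : ∑ Z ∈ (P.filter (Crosses · Λ)).filter (· ⊆ Y), exp (-(κ * dl Z)) ≤ K * ((Y ∩ Λ).card : ℝ) :=
    sum_crosses_subset_le (fun _ => (Real.exp_pos _).le) fun b hb => hK b (Finset.mem_inter.1 hb).2
  have hcardΛ : ((Y ∩ Λ).card : ℝ) ≤ ((Y ∩ Ω).card : ℝ) := by
    exact_mod_cast Finset.card_le_card (Finset.inter_subset_inter_left hΛΩ)
  have hcardΩ : ((Y ∩ Ω).card : ℝ) ≤ c₁ * (dl (Y ∩ Ω) + 1) := by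
    rcases (Y ∩ Ω).eq_empty_or_nonempty with h | h
    · rw [h, Finset.card_empty, Nat.cast_zero]
      have := hdl ∅
      positivity
    · exact hcard _ h
  have hexp : dl (Y ∩ Ω) + 1 ≤ exp (dl (Y ∩ Ω)) := Real.add_one_le_exp _
  calc |bterm P f Λ cpl Y|
      ≤ c * exp (-(a * dl (Y ∩ Ω))) * ∑ Z ∈ (P.filter (Crosses · Λ)).filter (· ⊆ Y), exp (-(κ * dl Z)) :=
        abs_bterm_le dl hc ha hf hmono hΛΩ hcpl Y
    _ ≤ c * exp (-(a * dl (Y ∩ Ω))) * (K * (c₁ * exp (dl (Y ∩ Ω)))) := by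
        refine mul_le_mul_of_nonneg_left (hsum.trans ?_) (by positivity)
        refine mul_le_mul_of_nonneg_left (hcardΛ.trans (hcardΩ.trans ?_)) hK0
        exact mul_le_mul_of_nonneg_left hexp hc₁
    _ = c * K * c₁ * exp (-((a - 1) * dl (Y ∩ Ω))) := by
        have : exp (-((a - 1) * dl (Y ∩ Ω))) = exp (-(a * dl (Y ∩ Ω))) * exp (dl (Y ∩ Ω)) := by
          rw [← Real.exp_add]; ring_nf
        rw [this]; ring

/-! ## §5 (G): the `B̃` terms — polymers outside `Λ_{k+1}` -/

/-- **(G)**: *"Terms in (foreign) with Z ⊂ Λ^c_{k+1} are the B̃_{k+1,𝚷⁺} terms in (city). These are estimated by …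
Σ_{□⊂Λ̄_k−Λ_{k+1}} Σ_{Z⊃□} e^{−L(κ−κ_0−2)d_{LM}(Z)} ≤ 𝒪(1)L³λ_k^{1/4−10ε}|Λ̄_k − Λ_{k+1}|_{LM}"* — for non-empty
polymers inside an ambient set `S` (print `Λ̄_k`), `|f Z| ≤ c·w(Z)` and the one-cube bound `Σ_{Z∋□} w Z ≤ K′`:
`|Σ_{Z∈P, Z∩Λ=∅} f Z| ≤ c·K′·|S − Λ|` (*"bounded by C|Λ_k − Λ_{k+1}|"*). [cite: Dimock2013BalabanII, §3.13 Lemma 3.15 proof (G) (arXiv:1212.5562v2 TeX L4725–4736)] -/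
theorem abs_sum_disjoint_le {f w : Finset C → ℝ} {c K' : ℝ} (hc : 0 ≤ c) (hw : ∀ Z, 0 ≤ w Z)
    (hf : ∀ Z ∈ P, |f Z| ≤ c * w Z) (S : Finset C) (hPS : ∀ Z ∈ P, Z ⊆ S) (hP : ∀ Z ∈ P, Z.Nonempty)
    (hK' : ∀ b ∈ S \ Λ, ∑ Z ∈ P.filter (fun Z => b ∈ Z), w Z ≤ K') :
    |∑ Z ∈ P.filter (fun Z => Disjoint Z Λ), f Z| ≤ c * K' * ((S \ Λ).card : ℝ) := by
  set D := P.filter (fun Z => Disjoint Z Λ) with hD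
  have hDP : D ⊆ P := Finset.filter_subset _ _
  calc |∑ Z ∈ D, f Z| ≤ ∑ Z ∈ D, |f Z| := Finset.abs_sum_le_sum_abs _ _
    _ ≤ ∑ Z ∈ D, c * w Z := Finset.sum_le_sum fun Z hZ => hf Z (hDP hZ)
    _ = c * ∑ Z ∈ D, w Z := by rw [Finset.mul_sum]
    _ ≤ c * ∑ b ∈ S \ Λ, ∑ Z ∈ P.filter (fun Z => b ∈ Z), w Z := by
        refine mul_le_mul_of_nonneg_left (sum_le_sum_cubes hDP (fun Z hZ => ?_) hw) hc
        obtain ⟨hZP, hZΛ⟩ := Finset.mem_filter.1 hZ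
        obtain ⟨b, hb⟩ := hP Z hZP
        exact ⟨b, Finset.mem_sdiff.2 ⟨hPS Z hZP hb, fun hbΛ => Finset.disjoint_left.1 hZΛ hb hbΛ⟩, hb⟩
    _ ≤ c * ∑ b ∈ S \ Λ, K' := mul_le_mul_of_nonneg_left (Finset.sum_le_sum hK') hc
    _ = c * K' * ((S \ Λ).card : ℝ) := by rw [Finset.sum_const, nsmul_eq_mul]; ring

end Bounds

/-! ## §6 On the cell's cube carrier `Pt d` with the Steiner length: every side condition discharged -/

section Steiner

open Literature.MathematicalPhysics.QuantumFieldTheory.Balaban1983to89.B13ScaleTransfer (Pt)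
open Literature.MathematicalPhysics.QuantumFieldTheory.Balaban1983to89.TreeLength (steinerLen steinerLen_nonneg
  card_le_steinerLen)
open Literature.MathematicalPhysics.QuantumFieldTheory.Balaban1983to89.B16MergeGeometry (steinerLen_mono)
open SteinerLengthSums (kumquat_steiner)

variable {d : ℕ}

/-- `|X| ≤ 2^d(4ℓ̃(X) + 1) ≤ 2^{d+2}(ℓ̃(X) + 1)` (App. E Lemma E.1 (3) on the carrier, `TreeLength.card_le_steinerLen`).
[cite: Dimock2013BalabanII, App. E Lemma E.1 (3) (arXiv:1212.5562v2 TeX L6790–6798)] -/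
theorem card_le_two_pow_mul (X : Finset (Pt d)) (hX : X.Nonempty) :
    (X.card : ℝ) ≤ 2 ^ (d + 2) * (steinerLen X + 1) := by
  have h := card_le_steinerLen hX
  have h0 := steinerLen_nonneg X
  have h2 : (0 : ℝ) ≤ 2 ^ d := by positivity
  calc (X.card : ℝ) ≤ 2 ^ d * (4 * steinerLen X + 1) := h
    _ ≤ 2 ^ (d + 2) * (steinerLen X + 1) := by rw [pow_add]; nlinarith

/-- **(drum1)–(drum2) ON THE CARRIER, constants explicit**: for non-empty polymers `P` on `Pt d = ℤ^d` with
`|f Z| ≤ c·e^{−(a+κ_0)ℓ̃(Z)}` (`a ≥ 0`), `Λ ⊆ Ω`, a completion map with `Z ⊆ Z⁺`, `Z⁺ ∩ Ω = Z ∩ Ω`, and `κ_0` past the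
threshold `3^d e^{−κ_0/(2+2^{d+2})} ≤ 1/8` of App. E Lemma E.2 (2):
`|B(Y)| ≤ c · 2e^{(κ_0/(2+2^{d+2}))(2^d−1)} · 2^{d+2} · e^{−(a−1)ℓ̃(Y ∩ Ω)}` — monotonicity (siouZ) by `steinerLen_mono`,
the one-cube bound by `kumquat_steiner`, the volume bound by `card_le_steinerLen`. [cite: Dimock2013BalabanII, §3.13 Lemma 3.15 proof (H) eqs. (siouZ)–(drum2) (arXiv:1212.5562v2 TeX L4756–4777)] -/
theorem abs_bterm_le_exp_steiner {P : Finset (Finset (Pt d))} {Λ Ω : Finset (Pt d)}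
    {cpl : Finset (Pt d) → Finset (Pt d)} {f : Finset (Pt d) → ℝ} {c a κ : ℝ} (hc : 0 ≤ c) (ha : 0 ≤ a)
    (hf : ∀ Z ∈ P, |f Z| ≤ c * exp (-((a + κ) * steinerLen Z))) (hΛΩ : Λ ⊆ Ω)
    (hcpl : ∀ Z ∈ P, Crosses Z Λ → Z ⊆ cpl Z ∧ cpl Z ∩ Ω = Z ∩ Ω)
    (hκ : (3 : ℝ) ^ d * exp (-(κ / (2 + 2 ^ (d + 2)))) ≤ 1 / 8) (Y : Finset (Pt d)) :
    |bterm P f Λ cpl Y| ≤ c * (2 * exp (κ / (2 + 2 ^ (d + 2)) * (2 ^ d - 1))) * 2 ^ (d + 2)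
        * exp (-((a - 1) * steinerLen (Y ∩ Ω))) :=
  abs_bterm_le_exp steinerLen hc ha hf (fun _ _ hA hAB => steinerLen_mono hAB hA) steinerLen_nonneg hΛΩ hcpl
    (fun b _ => kumquat_steiner hκ b _ fun _ hZ => (Finset.mem_filter.1 hZ).2) (by positivity)
    card_le_two_pow_mul (by positivity) Y

/-- **(G) ON THE CARRIER**: `|Σ_{Z∈P, Z∩Λ=∅} f Z| ≤ c · 2e^{(κ/(2+2^{d+2}))(2^d−1)} · |S − Λ|` for non-empty polymers
inside `S` with `|f Z| ≤ c·e^{−κℓ̃(Z)}`, `κ` past the threshold of App. E Lemma E.2 (2). [cite: Dimock2013BalabanII, §3.13 Lemma 3.15 proof (G) (arXiv:1212.5562v2 TeX L4725–4736)] -/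
theorem abs_sum_disjoint_le_steiner {P : Finset (Finset (Pt d))} {Λ : Finset (Pt d)} {f : Finset (Pt d) → ℝ}
    {c κ : ℝ} (hc : 0 ≤ c) (hf : ∀ Z ∈ P, |f Z| ≤ c * exp (-(κ * steinerLen Z))) (S : Finset (Pt d))
    (hPS : ∀ Z ∈ P, Z ⊆ S) (hP : ∀ Z ∈ P, Z.Nonempty)
    (hκ : (3 : ℝ) ^ d * exp (-(κ / (2 + 2 ^ (d + 2)))) ≤ 1 / 8) :
    |∑ Z ∈ P.filter (fun Z => Disjoint Z Λ), f Z|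
      ≤ c * (2 * exp (κ / (2 + 2 ^ (d + 2)) * (2 ^ d - 1))) * ((S \ Λ).card : ℝ) :=
  abs_sum_disjoint_le hc (fun _ => (Real.exp_pos _).le) hf S hPS hP
    fun b _ => kumquat_steiner hκ b _ fun _ hZ => (Finset.mem_filter.1 hZ).2

end Steiner

/-! ## §7 Non-vacuity -/

/-- Two cubes `0, 1`, `Λ = {0}`, `Ω = {0, 1}`, polymers `{0}`, `{1}`, `{0,1}`, `Z⁺ = Z`: the three classes of (city) are
`{0}` (inside), `{1}` (outside), `{0,1}` (crossing), and the split reads `f{0} + f{1} + f{0,1} = f{0} + B({0,1}) + f{1}`. -/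
example (f : Finset ℕ → ℤ) :
    ∑ Z ∈ ({{0}, {1}, {0, 1}} : Finset (Finset ℕ)), f Z
      = ∑ Z ∈ ({{0}, {1}, {0, 1}} : Finset (Finset ℕ)).filter (· ⊆ ({0} : Finset ℕ)), f Z
        + ∑ Y ∈ (({{0}, {1}, {0, 1}} : Finset (Finset ℕ)).filter (Crosses · ({0} : Finset ℕ))).image id,
            bterm ({{0}, {1}, {0, 1}} : Finset (Finset ℕ)) f {0} id Y
        + ∑ Z ∈ ({{0}, {1}, {0, 1}} : Finset (Finset ℕ)).filter (fun Z => Disjoint Z ({0} : Finset ℕ)), f Z :=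
  city _ f {0} id (by decide)

end Literature.MathematicalPhysics.QuantumFieldTheory.Dimock2011to13.ActiveBoundaryTerms

end
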